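import Summits.BirchSwinnertonDyer.BirchSwinnertonDyer.Theorems.ThetaPartnerAtTwoSignedMainConjectureCMTwoRankZeroPTDeepUnramifiedLocal
import HarnessLib

/-!
# Route `ThetaPartnerAtTwo` (TP2), crux K2R0P♭ (stmt-BirchSwinnertonDyer-26471; derived node K2r0P 24945), line `rankzero` v19,
# stub `stub_poitouTateDeepTwoGen` = (S_PT) — brick **B5c-core** of `Cruxes/SignedMainConjectureCMTwoRankZeroOfPub/PT-DEEP-HALF-DESIGN-w2g4.md` §6:
# membership in Kobayashi's `Sel^ε(E/K_m)` / `Sel^ε(E/K_∞)` ASSEMBLED from per-place data — signed Kummer at `v ∣ p`, classical (e.g. principal) at a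
# finite exceptional set `S ∌ p` and at `∞`, UNRAMIFIED over `K_∞` at the good places `v ∉ S` (brick B5b `…PTDeepUnramifiedLocal`)

HONEST FRAMING (cell `pub/bsd-wall`, W-ALL row 1; width seat `bsd-wall-tp2-p2-w2` g4, `--supports` only). THEOREMS ONLY (no definition, no named
fact, no instance, no `sorry`); closes no item; BSD is NOT proved by any of this. What remains of B5 after this file: the conversion of the Shapiro-side
data (w3's B2/B3: `y' ∈ H¹(Γ_n, A[2^k])` with torsion-level local conditions) into the four hypotheses (p)/(S)/(∞)/(ur) below — (S)/(∞) via
`Kobayashi2003.resOfLe_mem_localKerOver_of_principal`, (ur) via `resOfLe_kerSubgroup_inf_eq_zero_of_layer` (this file), (p) = the torsion-level Kummer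
witness pushed to `E[p^∞]` (cf. B1 `…PTDeepHypLayer`).

* `resOfLe_kerSubgroup_inf_eq_zero_of_layer` — unramified at the LAYER (`conj_σ y` zero on `Gal(K̄/K_m) ⊓ I`) ⟹ unramified over `K_∞` (`conj_σ (h_m y)` zero
  on `Gal(K̄/K_∞) ⊓ I`).
* `mem_signedSelmerLayer_of_local_data` — (p) ∧ (S) ∧ (∞) ∧ (ur) ⟹ `y ∈ signedSelmerLayer W κ ε m` (any number field `K`, prime `p`, `ℤ_p`-extension in which
  the good places outside `S` do not split completely — automatic for the cyclotomic one, `localSubgroup_kerSubgroup_ne_top_of_isCyclotomic`).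
* `layerToInfty_mem_signedSelmerInfty_of_local_data` — hence `h_m y ∈ signedSelmerInfty W κ ε`.

References: [Kobayashi2003] Def. 1.1 (p. 2); [GreenbergLNM1716] §2 (p. 70), §3 Lemma 3.3 (p. 86).
-/

set_option autoImplicit false
-- the Theorems namespace of this sub repeats the summit name by design (D-0017 nested layout)
set_option linter.dupNamespace false

noncomputable section

open scoped Classical NumberField

universe u

namespace Summit.BirchSwinnertonDyer.BirchSwinnertonDyer.Theorems

namespace SignedLowerOffTwo.PTDeep

open NumberField IsDedekindDomain Field IsDedekindDomain.HeightOneSpectrum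
  Literature.NumberTheory.EllipticCurves Literature.NumberTheory.GaloisRepresentations
  Literature.NumberTheory.EllipticCurves.GreenbergSelmer

/-! ## B5c-core: assembly into `Sel^ε(E/K_m)` and `Sel^ε(E/K_∞)` from per-place data -/

section Assembly

open Literature.NumberTheory.EllipticCurves.Kobayashi2003

variable {K : Type u} [Field K] [NumberField K] {p : ℕ} [Fact p.Prime] (κ : ZpExtension K p)

omit [NumberField K] in
/-- **Unramified at the layer ⟹ unramified over `K_∞`** (restriction): if `conj_σ y ∈ H¹(K_m, E[p^∞])` vanishes on `Gal(K̄/K_m) ⊓ I` then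
`conj_σ (h_m y)` vanishes on `Gal(K̄/K_∞) ⊓ I` (`h_m ∘ conj_σ = conj_σ ∘ h_m`, transitivity of restriction). [folklore] -/
theorem resOfLe_kerSubgroup_inf_eq_zero_of_layer (W : WeierstrassCurve K) (I : Subgroup (absoluteGaloisGroup K)) {m : ℕ}
    (y : W.subgroupH1 p (κ.layerSubgroup m)) (σ : absoluteGaloisGroup K)
    (h : resOfLe (W.geomPrimaryTorsion p) (inf_le_left : κ.layerSubgroup m ⊓ I ≤ κ.layerSubgroup m) (W.conjH1 p (κ.layerSubgroup m) σ y) = 0) :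
    resOfLe (W.geomPrimaryTorsion p) (inf_le_left : κ.kerSubgroup ⊓ I ≤ κ.kerSubgroup)
      (W.conjH1 p κ.kerSubgroup σ (W.layerToInfty κ m y)) = 0 := by
  rw [← W.layerToInfty_conjH1 κ]
  change resOfLe (W.geomPrimaryTorsion p) _ (resOfLe (W.geomPrimaryTorsion p) (κ.kerSubgroup_le_layerSubgroup m) _) = 0
  rw [← AddMonoidHom.comp_apply, resOfLe_comp_holds (M := W.geomPrimaryTorsion p),
    ← resOfLe_comp_holds (M := W.geomPrimaryTorsion p) (inf_le_inf_right I (κ.kerSubgroup_le_layerSubgroup m)) inf_le_left,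
    AddMonoidHom.comp_apply, h, map_zero]

/-- **B5c-core: membership in Kobayashi's `Sel^ε(E/K_m)` from per-place data.** `W/K` elliptic, `S` a finite set of finite places containing every bad
place prime to `p`; every good `v ∤ p` outside `S` not split completely in `K_∞`. A class `y ∈ H¹(K_m, E[p^∞])` such that, for every `σ ∈ Γ_K`:
(p) at `v ∣ p`, `conj_σ y` satisfies Kobayashi's signed Kummer condition `E^ε(K_m·K_v) ⊗ ℚ_p/ℤ_p`; (S) at `v ∈ S`, `v ∤ p`, and (∞) at the infinite places,
`conj_σ y` satisfies the classical condition (e.g. it is principal there: `Kobayashi2003.resOfLe_mem_localKerOver_of_principal`); (ur) at good `v ∉ S`,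
`v ∤ p`, `conj_σ (h_m y)` is unramified (zero on `Gal(K̄/K_∞) ⊓ I_v`) — lies in `Sel^ε(E/K_m)` (B5b at the places (ur); the signed condition refines the
classical one at `v ∣ p`, `localKummerOverOfEmb_le_localKerOverOfEmb`). [cite: Kobayashi2003, Def. 1.1] [cite: GreenbergLNM1716, §2 (p. 70), §3 Lemma 3.3 (p. 86)] -/
theorem mem_signedSelmerLayer_of_local_data (W : WeierstrassCurve K) [W.IsElliptic] (ε : ℤˣ) (S : Finset (HeightOneSpectrum (𝓞 K)))
    (hgood : ∀ v ∉ S, (p : 𝓞 K) ∉ v.asIdeal → W.HasGoodReductionAt v)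
    (hD : ∀ v ∉ S, (p : 𝓞 K) ∉ v.asIdeal → localSubgroup κ.kerSubgroup (v.adicCompletion K) ≠ ⊤)
    {m : ℕ} (y : W.subgroupH1 p (κ.layerSubgroup m))
    (hp : ∀ v : HeightOneSpectrum (𝓞 K), (p : 𝓞 K) ∈ v.asIdeal → ∀ σ : absoluteGaloisGroup K,
      W.conjH1 p (κ.layerSubgroup m) σ y ∈ localKummerOverOfEmb W p (κ.layerSubgroup m) (closureEmb (K := K) (v.adicCompletion K))
        (signedLocalPoints κ (v.adicCompletion K) W ε m))
    (hS : ∀ v ∈ S, (p : 𝓞 K) ∉ v.asIdeal → ∀ σ : absoluteGaloisGroup K,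
      W.conjH1 p (κ.layerSubgroup m) σ y ∈ W.localKerOver p (κ.layerSubgroup m) (v.adicCompletion K))
    (hinf : ∀ (w : InfinitePlace K) (σ : absoluteGaloisGroup K), W.conjH1 p (κ.layerSubgroup m) σ y ∈ W.localKerOver p (κ.layerSubgroup m) w.Completion)
    (hur : ∀ v ∉ S, (p : 𝓞 K) ∉ v.asIdeal → ∀ σ : absoluteGaloisGroup K,
      resOfLe (W.geomPrimaryTorsion p) (inf_le_left : κ.kerSubgroup ⊓ GreenbergSelmer.inertia (K := K) v ≤ κ.kerSubgroup)
        (W.conjH1 p κ.kerSubgroup σ (W.layerToInfty κ m y)) = 0) :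
    y ∈ signedSelmerLayer W κ ε m := by
  rw [mem_signedSelmerLayer_iff]
  refine ⟨?_, hp⟩
  change y ∈ W.selmerGroupOver p (κ.layerSubgroup m)
  rw [WeierstrassCurve.mem_selmerGroupOver_iff]
  refine ⟨fun v σ ↦ ?_, hinf⟩
  by_cases hpv : (p : 𝓞 K) ∈ v.asIdeal
  · rw [WeierstrassCurve.localKerOver_eq_ofEmb]
    exact localKummerOverOfEmb_le_localKerOverOfEmb _ (hp v hpv σ)
  by_cases hvS : v ∈ S
  · exact hS v hvS hpv σ
  · exact conjH1_mem_localKerOver_layer_of_resOfLe_inertia_eq_zero v κ W hpv (hgood v hvS hpv) (hD v hvS hpv) y σ (hur v hvS hpv σ)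

/-- **B5c-core, level `∞`**: under the hypotheses of `mem_signedSelmerLayer_of_local_data`, `h_m y ∈ Sel^ε(E/K_∞)`. [cite: Kobayashi2003, Def. 1.1] -/
theorem layerToInfty_mem_signedSelmerInfty_of_local_data (W : WeierstrassCurve K) [W.IsElliptic] (ε : ℤˣ) (S : Finset (HeightOneSpectrum (𝓞 K)))
    (hgood : ∀ v ∉ S, (p : 𝓞 K) ∉ v.asIdeal → W.HasGoodReductionAt v)
    (hD : ∀ v ∉ S, (p : 𝓞 K) ∉ v.asIdeal → localSubgroup κ.kerSubgroup (v.adicCompletion K) ≠ ⊤)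
    {m : ℕ} (y : W.subgroupH1 p (κ.layerSubgroup m))
    (hp : ∀ v : HeightOneSpectrum (𝓞 K), (p : 𝓞 K) ∈ v.asIdeal → ∀ σ : absoluteGaloisGroup K,
      W.conjH1 p (κ.layerSubgroup m) σ y ∈ localKummerOverOfEmb W p (κ.layerSubgroup m) (closureEmb (K := K) (v.adicCompletion K))
        (signedLocalPoints κ (v.adicCompletion K) W ε m))
    (hS : ∀ v ∈ S, (p : 𝓞 K) ∉ v.asIdeal → ∀ σ : absoluteGaloisGroup K,
      W.conjH1 p (κ.layerSubgroup m) σ y ∈ W.localKerOver p (κ.layerSubgroup m) (v.adicCompletion K))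
    (hinf : ∀ (w : InfinitePlace K) (σ : absoluteGaloisGroup K), W.conjH1 p (κ.layerSubgroup m) σ y ∈ W.localKerOver p (κ.layerSubgroup m) w.Completion)
    (hur : ∀ v ∉ S, (p : 𝓞 K) ∉ v.asIdeal → ∀ σ : absoluteGaloisGroup K,
      resOfLe (W.geomPrimaryTorsion p) (inf_le_left : κ.kerSubgroup ⊓ GreenbergSelmer.inertia (K := K) v ≤ κ.kerSubgroup)
        (W.conjH1 p κ.kerSubgroup σ (W.layerToInfty κ m y)) = 0) :
    W.layerToInfty κ m y ∈ signedSelmerInfty W κ ε :=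
  map_layerToInfty_signedSelmerLayer_le W κ ε m ⟨y, mem_signedSelmerLayer_of_local_data κ W ε S hgood hD y hp hS hinf hur, rfl⟩

end Assembly

end SignedLowerOffTwo.PTDeep

end Summit.BirchSwinnertonDyer.BirchSwinnertonDyer.Theorems

end
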